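import Mathlib
import HarnessLib
import Summits.NavierStokesRegularity.NavierStokesRegularity.Theses.SubOnsagerCeiling
import Summits.NavierStokesRegularity.NavierStokesRegularity.Theorems.SubOnsagerCeilingDefs
import Summits.NavierStokesRegularity.NavierStokesRegularity.Theorems.SubOnsagerCeilingOrthantTailCeilingDyadicRatioTwo
import Summits.NavierStokesRegularity.NavierStokesRegularity.Theorems.SubOnsagerCeilingForwardTailCeilingKPDyadicRange
import Summits.NavierStokesRegularity.NavierStokesRegularity.Theorems.SubOnsagerCeilingForwardTailCeilingKPDyadicMidRange
import Summits.NavierStokesRegularity.NavierStokesRegularity.Theorems.SubOnsagerCeilingForwardTailCeilingKPDyadicLowRange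
import Summits.NavierStokesRegularity.NavierStokesRegularity.Theorems.SubOnsagerCeilingGapChain
import Summits.NavierStokesRegularity.NavierStokesRegularity.Theorems.SubOnsagerCeilingGapArchitectures
import Summits.NavierStokesRegularity.NavierStokesRegularity.Theorems.SubOnsagerCeilingGapArchitectures3
import Summits.NavierStokesRegularity.NavierStokesRegularity.Theorems.SubOnsagerCeilingGapChain9
import Summits.NavierStokesRegularity.NavierStokesRegularity.Theorems.SubOnsagerCeilingKPSideBranchClassCeiling
import Summits.NavierStokesRegularity.NavierStokesRegularity.Theorems.SubOnsagerCeilingKPSideBranchClassTenCeiling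
import Summits.NavierStokesRegularity.NavierStokesRegularity.Theorems.SubOnsagerCeilingKPSecondaryAssemblyGraded
import Summits.NavierStokesRegularity.NavierStokesRegularity.Theorems.SubcriticalEnvelopeForwardSourceTailEnvelopeKPPermLow
import Summits.NavierStokesRegularity.NavierStokesRegularity.Theorems.SubcriticalEnvelopeForwardSourceTailEnvelopeKPFan
import Summits.NavierStokesRegularity.NavierStokesRegularity.Theorems.SubcriticalEnvelopeForwardSourceTailEnvelopeKPTwoCycleWide

set_option linter.unusedVariables false
set_option linter.dupNamespace false

/-! # LEAD skeleton «kp-shell-barrier» for the crux `SubOnsagerCeiling.ForwardTailCeilingKP`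
(stmt-NavierStokesRegularity-27057) — LEAD prover-ns-soc-p2-g3-0 / v3–v4 prover-ns-soc-p2-g4-0 / v5–v6 prover-ns-soc-p2-g5-0 /
v7–v8 prover-ns-soc-p2-g6-0, 2026-08-28 / v9–v13 prover-ns-soc-p2-g11-0, 2026-08-29 / v14–v19 prover-ns-soc-p2-g12-0, 2026-08-29.
MODEL LATTICE ONLY (rung TL-M2Break); no summit is proved by a line; nothing here bears on NS regularity.

Shape = the planner's birth skeleton «fwd-shell-barrier» of the dead-as-typed predecessor 26608
(Cruxes/ForwardTailCeiling/Lines/fwd_shell_barrier.lean) transported VERBATIM to the KP class: the per-table body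
`FwdCeilingKPAt R ε₀ α` carries the extra DIAGONAL-FEED clause `∀ a b i, a ≠ b → α a b i (0,0,1) = 0` of the rev-3 crux
(KP networks proper), everything else unchanged (∃ S ⊇ S⁺(α), ∃ θ > 1/2, ∃ C ≥ 0, ∀ ν …, bound on Σ_(k=n..N) Σ_(i∈S) ½X²).
Stubs by scale-ratio regime (split at ε₀ = 1/4); composition by case split. The landed rung
`Theorems.SubOnsagerCeiling.stub_dyadicRatioTwo` (scaled dyadic tables, ε₀ = 1, θ = 51/100, p610572) gives `FwdCeilingKPAt`
on that sub-class with S = univ (`fwdCeilingKPAt_of_ceilingAt`, proved below) — the BC5 witness of weakness of STUB 1;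
v2 (LEAD, same day): RUNG 2 `rung_dyadicRange` = the same for EVERY ratio b = 1+ε₀ ∈ [17/10, 2] (θ = 101/200), from the
landed files `Theorems/SubOnsagerCeilingDyadicRange{RegionIneq,Region,Chain}.lean` + `…ForwardTailCeilingKPDyadicRange.lean`;
v3 (LEAD g4, same day): RUNG 3 `rung_dyadicWideRange` = the same for EVERY ratio b ∈ [81/50, 2] (ε₀ ∈ [31/50, 1]): the range
[1.62, 1.72] from a THREE-WINDOW region (one extra linear cut (43/100)Yₙ − (19/20)Y_{n+1} + Y_{n+2} ≤ 27/40; abstract lemma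
`Theorems/SubOnsagerCeilingDyadicMidRangeRegion.lean`, Bernstein-certified inequalities `…MidRangeIneq*`, `…Holds*`, chain
`…MidRangeChain.lean`, wrapper `…ForwardTailCeilingKPDyadicMidRange.lean`), glued with RUNG 2; v4 (LEAD g4): RUNG 4 `rung_dyadicLowRange` = the same for EVERY b ∈ [25/16, 2] (ε₀ ∈ [9/16, 1]) — a SECOND
one-cut template (θ₀ .597, m₁ .707, m₂ −.107, c₁ 1.02, cut .429x − .957y + z ≤ .675) certified on [25/16, 81/50] by the same
abstract lemma and the LEAD's parametrized generator (files `…DyadicLowRange*`). No two-window BMR-type region exists below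
b ≈ 1.58 and the one-cut family runs out near p ≈ 1.55 (LEAD census); each further interval needs more windows/cuts.
v5 (LEAD g5, same day): RUNG 5 `rung_sideBranchClass` = the first rung OFF the one-mode chain class: the SIDE-BRANCH CLASS
(chain c₀ on 0 + in-shell pump 0→1 weight P + exit feed 1→2 weight f into a DEAD-END pocket — the 25507 witness
architecture) at every b ∈ [1.9, 2] with weights in the certified range (13P² < f²κ⁴, 5Pκb^{5/2} ≤ c₀b^{2θ},
Pb^{5/2} ≤ 2c₀b^{2θ}), from the landed JOINT REGION «chain barrier under slaved damping + pair slaving of the side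
source» (`Theorems/SubOnsagerCeilingKPSideBranchClass{Dynamics,Steps,Envelopes,Ceiling}.lean`,
`…KPPairSlaving*.lean`, `…DyadicDamped*.lean`); wired as a case of `ForwardTailCeilingKP_of`.
v6 (LEAD g5, tenure g2 disposition 17:56:35Z (A)–(D)): STRUCTURAL RE-CUT OF THE STUBS. The v1–v5 stubs «FwdCeilingKPAt
for every table, split at ε₀ = 1/4» were not work units. v6 states what the landed machinery reduces the crux to:
by LEAD SE's graded assembly `fwdCeilingKP_of_gradedEnvelope` (p651249/…Graded: multi-step pair slaving of all secondary
sources, S = S⁺(α)), the crux for a table follows from a GRADING `lev : Fin 4 → ℕ` of its modes with the structural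
clauses `GradedStruct α lev` (every non-primary source is fed / partnered / target-drained only by admissible modes of
lower level) together with a ν-UNIFORM θ-BARRIER OF THE LEVEL-0 («primary») MODES. So the registered stubs are now
`stub_primaryGradedLargeRatio` (1/4 < ε₀ ≤ 1) and `stub_primaryGradedSmallRatio` (ε₀ ≤ 1/4): «every KP network
proper of E₂(R) admits a grading whose primary modes obey a ν-uniform θ-shell barrier, 1/2 < θ ≤ 1» (`PrimaryGradedAt`).
This is where ALL the remaining difficulty lives: the primaries contain the Katz–Pavlović chain at every b
(λ-uniform BMR/CZ — ≥ open in print, KEY-NS #124 (B): a price, not a strike) AND carry the slaved in-shell drains of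
their secondaries (the joint-region problem RUNG 5 solves for small drains at b ∈ [1.9,2]) AND, for tables with
re-entry / in-shell pump cycles among non-sources, must absorb those modes at level 0. S-sec (secondary sources)
is DONE and cited by name in the composition; S-sink is identity-level (inside `kpProper_quadTerm_source_le`).
Rungs 1–5 stay wired as proved corners.
v7 (LEAD g6, 2026-08-28): three more PROVED CORNERS wired, no stub change — LEAD SE's (ns-senv-p1) architecture rungs for the
sister crux 27130, which are `CeilingAt` statements and therefore transfer verbatim through `fwdCeilingKPAt_of_ceilingAt`:
RUNG 6 `rung_kpPerm` (uniform KP PERMUTATION networks `kpPermTable σ c`, `c` constant on `σ`-orbits, every `ε₀ ∈ [9/16, 1]`;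
`Theorems.kpPermLowWide_ceilingAt`, p640129 + its low-range extension), RUNG 7 `rung_kpFan` (uniform KP FAN networks
`kpFanTable w`, every `w`, every `ε₀ ∈ [9/16, 1]`; `Theorems.kpFanWide_ceilingAt`), RUNG 8 `rung_kpTwoCycle` (the uniform
2-cycle = re-entry pair `kpTwoCycleTable c c`, every `ε₀ ∈ [31/50, 1]`; `Theorems.kpTwoCycleWide_ceilingAt`). The proved
class of the composition is now {scaled dyadic, uniform permutation, uniform fan} × [9/16, 1] ∪ {uniform 2-cycle} × [31/50, 1]
∪ {side-branch class} × [9/10, 1]; everything else is the two stubs. LEAD g6 census v9 (Lines/kp_shell_barrier.md §G) records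
the METHOD LIMITS measured this generation: the maximal K-coupled TWO-window region dies at p* ≈ 1.50 (b* ≈ 1.51), tolerates
adversarial damping slack ≈ 0.2–0.3 at b ∈ [1.9, 2] and rate alternation down to L ≈ 2.0 at b = 2 — so every further
rung below b ≈ 1.5, the witness α_SB itself, and asymmetric re-entry need ≥ 3-window regions (or a new idea).
v8 (LEAD g6): RUNG 9 `rung_sideBranchClassTen` — the side-branch class with HALF the pump (`13P² < f²κ⁴`,
`10Pκb^{5/2} ≤ c₀b^{2θ}`, `Pb^{5/2} ≤ c₀b^{2θ}`; e.g. `c₀ = f = κ = 1`, `P ≤ 1/40`) at EVERY `b ∈ [89/50, 2]` (tenure successor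
item (1) of 18:01:53Z): the damped two-window template re-certified at threshold `p ≥ 7/4` with slack `1/10`
(`Theorems/SubOnsagerCeilingDyadicDampedTen{RegionIneq,RegionForced,ChainForced}.lean`,
`…KPSideBranchClassTen{Steps,Envelopes,Ceiling,Witness}.lean`, all `--supports 27057 --as helper`). Stubs UNCHANGED.
SIZE (LEAD census, honest): restricted to α = c·dyadicTable both stubs contain the λ-UNIFORM Barbato–Morandin–Romito /
Cheskidov–Zaya regularising region for the Katz–Pavlović chain (in print at ONE ratio only: arXiv:1007.3401, 1310.7612;
asked for in arXiv:1506.07480 p.3) ⇒ each stub is ≥ an open-in-print problem (XL); no S/M/L structural stub exists today.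
v9 (LEAD g11, 2026-08-29): RUNG 10 `rung_dyadicGapRange` — the one-mode chain at EVERY `b ∈ [3/2, 2]` (`ε₀ ∈ [1/2, 1]`): the gap
`[3/2, 25/16]` below RUNG 4 closed by the FIRST rung of the Ω-coupled four-window general-face format (ten-face family «d45»:
caps, cubic floors, two corner caps, bulk + carved quadric floors; `Theorems/SubOnsagerCeilingGap{Faces,Kernel,Bridge,Cert*,Slice*,Chain}.lean`,
kernel certificates by fixed-point AFFINE arithmetic `Theorems/SubOnsagerCeilingVirtualFloorKernelFaceAffine.lean`, ≈ 6 900 kd-leaves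
on three b-slices); and (v10) RUNGS 6–8 transported to the same range through LEAD SE's strand transfers
(`Theorems/SubOnsagerCeilingGapArchitectures.lean`: uniform KP permutation / fan networks and the uniform 2-cycle at every
`ε₀ ∈ [1/2, 1]`); and (v11) RUNG 10b: the chain corner extended to `ε₀ ∈ [49/100, 1]` by the PARAMETRIC ROUTE
(`Theorems/SubOnsagerCeilingGapFamily{,Kernel}.lean`: a design is a `Params` datum; worked instance = slice `[149/100, 3/2]` of
design «d45», `Theorems/SubOnsagerCeilingGapChain2.lean`). Stubs UNCHANGED; the chain corner of the composition starts at
`ε₀ = 49/100`, and so do the permutation / fan / 2-cycle corners (`Theorems/SubOnsagerCeilingGapArchitectures2.lean`); (v12) RUNG 11: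
the chain corner at `ε₀ = 47/100` by the first FITTED design «d147θ» (`Theorems/SubOnsagerCeilingGapChain3.lean`; the design fitter
`fit2.py` is in the instruments file, part 2); (v13) RUNG 12: a second fitted design «d145θ» — the chain corner
at `ε₀ = 9/20` (`Theorems/SubOnsagerCeilingGapChain4.lean`); (v14, LEAD g12) the permutation / fan / 2-cycle corners also at `9/20`
(`Theorems/SubOnsagerCeilingGapArchitectures3.lean`, landed p722126): every architecture corner of the composition now starts at b = 29/20;
(v15, LEAD g12) RUNG 13: the chain corner at `ε₀ = 11/25` (`Theorems/SubOnsagerCeilingGapChain5.lean`: slice `[36/25, 29/20]` by the design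
«d144θ» — found by the bound-based fitter once the cubic-floor coefficient `κ` is freed; LEAD census v15 §M locates the END of the d45
face topology at `b ≈ 1.43` (caps-versus-cubic-floor squeeze) and lands the topology-as-a-datum files `Theorems/SubOnsagerCeilingGapSpec{,Kernel}.lean`
for the successor topologies); (v16, LEAD g12) RUNG 14: the chain corner at `ε₀ = 21/50` (`Theorems/SubOnsagerCeilingGapChain6.lean`: slices
`[71/50, 143/100]`, `[143/100, 36/25]` by the designs «dI», «dH» of the NEW 13-face topology «d45 + three ratio caps
x_{k+1} ≤ δ + γ x_k» written as spec lists `Fin 13 → GapSpec.Spec` — the first rungs BELOW the d45 topology's end, landed with zero new Lean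
per design through the topology-as-a-datum route); (v17) RUNG 15: the chain corner at `ε₀ = 2/5` (`Theorems/SubOnsagerCeilingGapChain7.lean`:
slices `[7/5, 141/100]`, `[141/100, 71/50]` by the designs «dK», «dJ» — κ and the ratio-cap coefficients re-fitted per slice by the LP); (v18) RUNG 16: the chain corner at `ε₀ = 19/50` (`Theorems/SubOnsagerCeilingGapChain8.lean`:
slices `[69/50, 139/100]`, `[139/100, 7/5]` by «dM», «dL» — per-pair κ: the bottom-pair cubic floor gets its own κ₀); (v19) RUNG 17: the chain corner at `ε₀ = 37/100` (`Theorems/SubOnsagerCeilingGapChain9.lean`: slice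
`[137/100, 69/50]` by «dN»). -/

open Summit.NavierStokesRegularity.NavierStokesRegularity.Theses.SubOnsagerCeiling
open Summit.NavierStokesRegularity.NavierStokesRegularity.Theorems.SubOnsagerCeiling

namespace Summit.NavierStokesRegularity.NavierStokesRegularity.Cruxes.ForwardTailCeilingKP.KPShellBarrier

/-- Per-table body of `ForwardTailCeilingKP` (verbatim after the binders `R, 1 ≤ R, ε₀, 0 < ε₀, ε₀ ≤ 1, α`). -/
def FwdCeilingKPAt (R ε₀ : ℝ) (α : Fin 4 → Fin 4 → Fin 4 → ℤ × ℤ × ℤ → ℝ) : Prop :=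
  Literature.Analysis.FluidPDE.TaoCascade.InTableClass R α → (∀ (Y : Fin 4 → ℤ → ℝ → ℝ) (τ : ℝ), (∀ (j : Fin 4) (k : ℤ), 1 ≤ k → 0 ≤ Y j k τ) → ∀ δ : ℝ, 0 < δ → ∀ (i : Fin 4) (n : ℤ), 1 ≤ n → Y i n τ = 0 → 0 ≤ Literature.Analysis.FluidPDE.TaoCascade.quadTerm δ α Y i n τ) → (∀ a b i : Fin 4, a ≠ b → α a b i (0, 0, 1) = 0) → ∃ S : Finset (Fin 4), (∀ i, i ∉ S → ∀ j l : Fin 4, α i j l (0, 0, 1) = 0) ∧ ∃ θ : ℝ, 1 / 2 < θ ∧ ∃ C : ℝ, 0 ≤ C ∧ ∀ ν : ℝ, 0 < ν → ∀ (X₀ : Fin 4 → ℝ) (s : ℝ), 0 < s → ∀ X : Fin 4 → ℤ → ℝ → ℝ, (∀ (i : Fin 4) (k : ℤ), X i k 0 = if k = 0 then X₀ i else 0) → (∀ (i : Fin 4) (k : ℤ), k < 0 → ∀ t : ℝ, X i k t = 0) → (∃ M : ℝ, ∀ (t : ℝ) (i : Fin 4) (k : ℤ), (1 + (1 + ε₀)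 ^ ((10 : ℝ) * k)) * |X i k t| ≤ M) → (∀ (i : Fin 4) (k : ℤ), Continuous (X i k)) → (∀ (i : Fin 4) (k : ℤ), ∀ t ∈ Set.Icc (0 : ℝ) s, HasDerivWithinAt (X i k) (Literature.Analysis.FluidPDE.TaoCascade.quadTerm ε₀ α X i k t - ν * (1 + ε₀) ^ ((2 : ℝ) * k) * X i k t) (Set.Icc (0 : ℝ) s) t) → (∀ t ∈ Set.Icc (0 : ℝ) s, ∀ (i : Fin 4) (k : ℤ), 1 ≤ k → 0 ≤ X i k t) → ∀ n N : ℕ, n ≤ N → ∀ t ∈ Set.Icc (0 : ℝ) s, ∑ k ∈ Finset.Icc n N, ∑ i ∈ S, (1 / 2 : ℝ) * X i (k : ℤ) t ^ 2 ≤ C * (∑ i : Fin 4, (1 / 2 : ℝ) * X₀ i ^ 2) * (1 + ε₀) ^ (-(2 * θ * (n : ℝ)))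

/-- The crux is, definitionally, `FwdCeilingKPAt` at every spread, ratio and table. -/
theorem forwardTailCeilingKP_iff :
    ForwardTailCeilingKP ↔ ∀ R : ℝ, 1 ≤ R → ∀ ε₀ : ℝ, 0 < ε₀ → ε₀ ≤ 1 →
      ∀ α : Fin 4 → Fin 4 → Fin 4 → ℤ × ℤ × ℤ → ℝ, FwdCeilingKPAt R ε₀ α := Iff.rfl

/-- total-energy ceiling ⇒ KP forward-source ceiling (S = univ, the diagonal clause unused); so every landed `CeilingAt`
rung transfers. -/
theorem fwdCeilingKPAt_of_ceilingAt {R ε₀ : ℝ} {α : Fin 4 → Fin 4 → Fin 4 → ℤ × ℤ × ℤ → ℝ}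
    (h : CeilingAt R ε₀ α) : FwdCeilingKPAt R ε₀ α := by
  intro hα hO _hD
  obtain ⟨θ, hθ, C, hC, H⟩ := h hα hO
  refine ⟨Finset.univ, fun i hi => absurd (Finset.mem_univ i) hi, θ, hθ, C, hC, ?_⟩
  intro ν hν X₀ s hs X hX0 hXneg hM hXc hXd hXpos n N hnN t ht
  simpa using H ν hν X₀ s hs X hX0 hXneg hM hXc hXd hXpos n N hnN t ht

/-- Two-level weighted shell barrier ⇒ tail ceiling (geometric series; copied verbatim from the registered predecessor
skeletons Cruxes/OrthantTailCeiling/Lines/shell_barrier.lean and Cruxes/ForwardTailCeiling/Lines/fwd_shell_barrier.lean,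
which are not built on the farm, hence the copy). -/
theorem ceilingAt_of_shellBarrier {R ε₀ : ℝ} (hε : 0 < ε₀)
    {α : Fin 4 → Fin 4 → Fin 4 → ℤ × ℤ × ℤ → ℝ} (h : ShellBarrierAt R ε₀ α) : CeilingAt R ε₀ α := by
  intro hT hO
  obtain ⟨θ, hθ, D, hD, H⟩ := h hT hO
  have hb : (1 : ℝ) < 1 + ε₀ := by linarith
  have hb0 : (0 : ℝ) ≤ 1 + ε₀ := by linarith
  set r : ℝ := (1 + ε₀) ^ (-(2 * θ)) with hr_def
  have hr0 : 0 < r := Real.rpow_pos_of_pos (by linarith) _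
  have hr1 : r < 1 := by
    have : (1 + ε₀) ^ (-(2 * θ)) < (1 + ε₀) ^ (0 : ℝ) :=
      Real.rpow_lt_rpow_of_exponent_lt hb (by linarith)
    simpa [hr_def] using this
  have h1r : 0 < 1 - r := by linarith
  refine ⟨θ, hθ, 4 * D / (1 - r), by positivity, ?_⟩
  intro ν hν X₀ s hs X hdat hvan hbdd hcont hode hnn n N hnN t ht
  set E₀ : ℝ := ∑ j : Fin 4, (1 / 2 : ℝ) * X₀ j ^ 2 with hE₀
  have hE₀0 : 0 ≤ E₀ := Finset.sum_nonneg fun j _ => by positivity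
  have hpow : ∀ k : ℕ, (1 + ε₀) ^ (2 * θ * (k : ℝ)) * r ^ k = 1 := by
    intro k
    rw [hr_def, ← Real.rpow_mul_natCast hb0, ← Real.rpow_add (by linarith)]
    have : 2 * θ * (k : ℝ) + -(2 * θ) * (k : ℝ) = 0 := by ring
    rw [this, Real.rpow_zero]
  have hshell : ∀ k : ℕ, ∑ i : Fin 4, (1 / 2 : ℝ) * X i (k : ℤ) t ^ 2 ≤ 4 * D * E₀ * r ^ k := by
    intro k
    have hk : ∀ i : Fin 4, (1 / 2 : ℝ) * X i (k : ℤ) t ^ 2 ≤ D * E₀ * r ^ k := by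
      intro i
      have Hi := H ν hν X₀ s hs X hdat hvan hbdd hcont hode hnn t ht i k
      have hrk : 0 < r ^ k := pow_pos hr0 k
      have := mul_le_mul_of_nonneg_right Hi hrk.le
      calc (1 / 2 : ℝ) * X i (k : ℤ) t ^ 2
          = ((1 + ε₀) ^ (2 * θ * (k : ℝ)) * r ^ k) * ((1 / 2 : ℝ) * X i (k : ℤ) t ^ 2) := by rw [hpow k, one_mul]
        _ = (1 + ε₀) ^ (2 * θ * (k : ℝ)) * ((1 / 2 : ℝ) * X i (k : ℤ) t ^ 2) * r ^ k := by ring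
        _ ≤ D * (∑ j : Fin 4, (1 / 2 : ℝ) * X₀ j ^ 2) * r ^ k := this
        _ = D * E₀ * r ^ k := by rw [hE₀]
    calc ∑ i : Fin 4, (1 / 2 : ℝ) * X i (k : ℤ) t ^ 2
        ≤ ∑ _i : Fin 4, D * E₀ * r ^ k := Finset.sum_le_sum fun i _ => hk i
      _ = 4 * D * E₀ * r ^ k := by simp [Finset.sum_const, Finset.card_univ, Fintype.card_fin]; ring
  have hgeom : ∑ k ∈ Finset.Icc n N, r ^ k ≤ r ^ n / (1 - r) := by
    rw [← Finset.Ico_add_one_right_eq_Icc]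
    exact geom_sum_Ico_le_of_lt_one hr0.le hr1
  have hrn : r ^ n = (1 + ε₀) ^ (-(2 * θ * (n : ℝ))) := by
    rw [hr_def, ← Real.rpow_mul_natCast hb0]
    congr 1; ring
  calc ∑ k ∈ Finset.Icc n N, ∑ i : Fin 4, (1 / 2 : ℝ) * X i (k : ℤ) t ^ 2
      ≤ ∑ k ∈ Finset.Icc n N, 4 * D * E₀ * r ^ k := Finset.sum_le_sum fun k _ => hshell k
    _ = 4 * D * E₀ * ∑ k ∈ Finset.Icc n N, r ^ k := by rw [Finset.mul_sum (s := Finset.Icc n N)]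
    _ ≤ 4 * D * E₀ * (r ^ n / (1 - r)) :=
        mul_le_mul_of_nonneg_left hgeom (by positivity)
    _ = 4 * D / (1 - r) * E₀ * (1 + ε₀) ^ (-(2 * θ * (n : ℝ))) := by rw [← hrn]; field_simp
    _ = 4 * D / (1 - r) * (∑ i : Fin 4, (1 / 2 : ℝ) * X₀ i ^ 2) * (1 + ε₀) ^ (-(2 * θ * (n : ℝ))) := by
        rw [hE₀]

/-- RUNG (landed, p610572): scaled dyadic tables at ε₀ = 1 satisfy the KP forward ceiling. -/
theorem rung_dyadicRatioTwo : ∀ R : ℝ, 1 ≤ R → ∀ α : Fin 4 → Fin 4 → Fin 4 → ℤ × ℤ × ℤ → ℝ,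
    IsScaledDyadic α → FwdCeilingKPAt R 1 α := by
  intro R hR α hα
  have h := Summit.NavierStokesRegularity.NavierStokesRegularity.Theorems.SubOnsagerCeiling.stub_dyadicRatioTwo
  exact fwdCeilingKPAt_of_ceilingAt (ceilingAt_of_shellBarrier one_pos (h R hR α hα))

/-- RUNG 2 (landed by the LEAD, 2026-08-28: p624603 / p624803 / p625516 + the wrapper
`Theorems/SubOnsagerCeilingForwardTailCeilingKPDyadicRange.lean`): scaled dyadic tables satisfy the KP forward ceiling at
EVERY scale ratio `1+ε₀ ∈ [17/10, 2]` (θ = 101/200, D = 100; re-tuned Barbato–Morandin–Romito region, slope m = 1/2,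
valid iff p = b^{197/200} ≥ 42/25; NEW beyond print, where the region is pinned to λ = 2). -/
theorem rung_dyadicRange : ∀ R : ℝ, 1 ≤ R → ∀ ε₀ : ℝ, 7 / 10 ≤ ε₀ → ε₀ ≤ 1 →
    ∀ α : Fin 4 → Fin 4 → Fin 4 → ℤ × ℤ × ℤ → ℝ, IsScaledDyadic α → FwdCeilingKPAt R ε₀ α := by
  intro R _hR ε₀ hε hε1 α hα
  exact fwdCeilingKPAt_of_ceilingAt (ceilingAt_of_shellBarrier (by linarith)
    (Summit.NavierStokesRegularity.NavierStokesRegularity.Theorems.dyadicRange_shellBarrierAt R ε₀ hε hε1 α hα))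

/-- RUNG 3 (landed by the LEAD g4, 2026-08-28: `Theorems/SubOnsagerCeilingForwardTailCeilingKPDyadicMidRange.lean` and
its imports): scaled dyadic tables satisfy the KP forward ceiling at EVERY scale ratio `1+ε₀ ∈ [81/50, 2]` (θ = 101/200,
D = 100; three-window region on [81/50, 43/25] glued with the two-window range [17/10, 2]). -/
theorem rung_dyadicWideRange : ∀ R : ℝ, 1 ≤ R → ∀ ε₀ : ℝ, 31 / 50 ≤ ε₀ → ε₀ ≤ 1 →
    ∀ α : Fin 4 → Fin 4 → Fin 4 → ℤ × ℤ × ℤ → ℝ, IsScaledDyadic α → FwdCeilingKPAt R ε₀ α := by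
  intro R _hR ε₀ hε hε1 α hα
  exact fwdCeilingKPAt_of_ceilingAt (ceilingAt_of_shellBarrier (by linarith)
    (Summit.NavierStokesRegularity.NavierStokesRegularity.Theorems.dyadicWideRange_shellBarrierAt R ε₀ hε hε1 α hα))

/-- RUNG 4 (landed by the LEAD g4, 2026-08-28: `Theorems/SubOnsagerCeilingForwardTailCeilingKPDyadicLowRange.lean` and
its imports): scaled dyadic tables satisfy the KP forward ceiling at EVERY scale ratio `1+ε₀ ∈ [25/16, 2]` (θ = 101/200,
D = 100; second one-cut three-window template on [25/16, 81/50] glued with RUNG 3). -/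
theorem rung_dyadicLowRange : ∀ R : ℝ, 1 ≤ R → ∀ ε₀ : ℝ, 9 / 16 ≤ ε₀ → ε₀ ≤ 1 →
    ∀ α : Fin 4 → Fin 4 → Fin 4 → ℤ × ℤ × ℤ → ℝ, IsScaledDyadic α → FwdCeilingKPAt R ε₀ α := by
  intro R _hR ε₀ hε hε1 α hα
  exact fwdCeilingKPAt_of_ceilingAt (ceilingAt_of_shellBarrier (by linarith)
    (Summit.NavierStokesRegularity.NavierStokesRegularity.Theorems.dyadicLowRangeWide_shellBarrierAt R ε₀ hε hε1 α hα))

/-- RUNGS 10 / 10b / 11 / 12 / 13 / 14 (LEAD g11: `Theorems/SubOnsagerCeilingGapChain{,2,3,4}.lean`; LEAD g12: `…GapChain5.lean`, `…GapChain6.lean`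
`…GapChain7.lean`, `…GapChain8.lean`, `…GapChain9.lean` and their imports): scaled dyadic tables satisfy the KP forward ceiling at EVERY scale ratio `1+ε₀ ∈ [137/100, 2]` (θ = 101/200, D = 100; the gap
`[3/2, 25/16]` from the Ω-coupled four-window general-face certificate «d45» (RUNG 10), `[149/100, 3/2]` from the same design through the
parametric route (RUNG 10b), `[147/100, 149/100]` / `[29/20, 147/100]` from the fitted designs «d147θ» / «d145θ» (RUNGS 11/12),
`[36/25, 29/20]` from «d144θ» (RUNG 13, fitter with the cubic-floor coefficient freed), `[137/100, 36/25]` from the spec-list designs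
«dH» … «dN» of the 13-face topology (RUNGS 14–17), glued with RUNG 4). -/
theorem rung_dyadicGapRange : ∀ R : ℝ, 1 ≤ R → ∀ ε₀ : ℝ, 37 / 100 ≤ ε₀ → ε₀ ≤ 1 →
    ∀ α : Fin 4 → Fin 4 → Fin 4 → ℤ × ℤ × ℤ → ℝ, IsScaledDyadic α → FwdCeilingKPAt R ε₀ α := by
  intro R _hR ε₀ hε hε1 α hα
  exact fwdCeilingKPAt_of_ceilingAt (ceilingAt_of_shellBarrier (by linarith)
    (Summit.NavierStokesRegularity.NavierStokesRegularity.Theorems.dyadicGapRange9Wide_shellBarrierAt R ε₀ hε hε1 α hα))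

/-- The side-branch class hypotheses at a table (def-free conjunction used only inside this skeleton's case split):
couplings chain `c₀`, pump `0→1` weight `P`, exit feed `1→2` weight `f`, no differential triads, admissible weights. -/
def SideBranchClassAt (ε₀ : ℝ) (α : Fin 4 → Fin 4 → Fin 4 → ℤ × ℤ × ℤ → ℝ) : Prop :=
  ∃ c₀ P f κ : ℝ,
    (∀ a c : Fin 4, α a a c (0, 0, 1) = (if a = 0 ∧ c = 0 then c₀ else 0) + (if a = 1 ∧ c = 2 then f else 0)) ∧
    (∀ a c : Fin 4, a ≠ c → α a a c (0, 0, 0) = if a = 0 ∧ c = 1 then P else 0) ∧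
    (∀ a b c : Fin 4, a ≠ b → a ≠ c → b ≠ c → α a b c (0, 0, 0) = 0) ∧
    0 < c₀ ∧ 0 ≤ P ∧ 0 < f ∧ 0 < κ ∧ 13 * P ^ 2 < f ^ 2 * κ ^ 4 ∧
    5 * P * κ * (1 + ε₀) ^ ((5 : ℝ) / 2) ≤ c₀ * ((1 + ε₀) ^ ((101 : ℝ) / 200)) ^ 2 ∧
    P * (1 + ε₀) ^ ((5 : ℝ) / 2) ≤ 2 * c₀ * ((1 + ε₀) ^ ((101 : ℝ) / 200)) ^ 2

/-- RUNG 5 (landed by the LEAD g5, 2026-08-28: `Theorems/SubOnsagerCeilingKPSideBranchClassCeiling.lean` and its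
imports): every table of the SIDE-BRANCH CLASS satisfies the KP forward ceiling at EVERY scale ratio `1+ε₀ ∈ [1.9, 2]`
(S = {0,1}, θ = 101/200) — the joint region «chain barrier under slaved damping + pair slaving». -/
theorem rung_sideBranchClass : ∀ R : ℝ, ∀ ε₀ : ℝ, 9 / 10 ≤ ε₀ → ε₀ ≤ 1 →
    ∀ α : Fin 4 → Fin 4 → Fin 4 → ℤ × ℤ × ℤ → ℝ, SideBranchClassAt ε₀ α → FwdCeilingKPAt R ε₀ α := by
  intro R ε₀ hε hε1 α hcl
  obtain ⟨c₀, P, f, κ, hw, hP, hCz, hc₀, hP0, hf, hκ, hpair, hdrain, hP1⟩ := hcl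
  exact Summit.NavierStokesRegularity.NavierStokesRegularity.Theorems.sideClass_fwdCeilingKP R hε hε1 hw hP hCz
    hc₀ hP0 hf hκ hpair hdrain hP1

/-- The HALVED-PUMP side-branch class hypotheses at a table (LEAD g6, RUNG 9): the same architecture as
`SideBranchClassAt` with the smallness conditions `13P² < f²κ⁴`, `10Pκb^{5/2} ≤ c₀b^{2θ}`, `Pb^{5/2} ≤ c₀b^{2θ}`
(side drain at most one TENTH of the chain's rate scale), which the damped template tolerates down to `b = 89/50`. -/
def SideBranchClassTenAt (ε₀ : ℝ) (α : Fin 4 → Fin 4 → Fin 4 → ℤ × ℤ × ℤ → ℝ) : Prop :=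
  ∃ c₀ P f κ : ℝ,
    (∀ a c : Fin 4, α a a c (0, 0, 1) = (if a = 0 ∧ c = 0 then c₀ else 0) + (if a = 1 ∧ c = 2 then f else 0)) ∧
    (∀ a c : Fin 4, a ≠ c → α a a c (0, 0, 0) = if a = 0 ∧ c = 1 then P else 0) ∧
    (∀ a b c : Fin 4, a ≠ b → a ≠ c → b ≠ c → α a b c (0, 0, 0) = 0) ∧
    0 < c₀ ∧ 0 ≤ P ∧ 0 < f ∧ 0 < κ ∧ 13 * P ^ 2 < f ^ 2 * κ ^ 4 ∧
    10 * P * κ * (1 + ε₀) ^ ((5 : ℝ) / 2) ≤ c₀ * ((1 + ε₀) ^ ((101 : ℝ) / 200)) ^ 2 ∧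
    P * (1 + ε₀) ^ ((5 : ℝ) / 2) ≤ c₀ * ((1 + ε₀) ^ ((101 : ℝ) / 200)) ^ 2

/-- RUNG 9 (LEAD g6, 2026-08-28: `Theorems/SubOnsagerCeilingKPSideBranchClassTenCeiling.lean` and its imports):
every table of the HALVED-PUMP side-branch class satisfies the KP forward ceiling at EVERY scale ratio
`1+ε₀ ∈ [1.78, 2]` (S = {0,1}, θ = 101/200) — the joint region «chain barrier under slaved damping + pair
slaving» with the damped faces re-certified at `p ≥ 7/4`, slack `1/10`. Non-vacuous: `Theorems.sideClassTen_nonempty`. -/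
theorem rung_sideBranchClassTen : ∀ R : ℝ, ∀ ε₀ : ℝ, 39 / 50 ≤ ε₀ → ε₀ ≤ 1 →
    ∀ α : Fin 4 → Fin 4 → Fin 4 → ℤ × ℤ × ℤ → ℝ, SideBranchClassTenAt ε₀ α → FwdCeilingKPAt R ε₀ α := by
  intro R ε₀ hε hε1 α hcl
  obtain ⟨c₀, P, f, κ, hw, hP, hCz, hc₀, hP0, hf, hκ, hpair, hdrain, hP1⟩ := hcl
  exact Summit.NavierStokesRegularity.NavierStokesRegularity.Theorems.sideClass_fwdCeilingKP_ten R hε hε1 hw hP hCz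
    hc₀ hP0 hf hκ hpair hdrain hP1

/-- RUNG 6 (LEAD SE ns-senv-p1, landed for the sister crux 27130: `Theorems.kpPermLowWide_ceilingAt` and its imports;
wired here by LEAD g6): uniform KP PERMUTATION networks `kpPermTable σ c` (feed `a → σ a` with weight `c a`, `c` constant
on `σ`-orbits) satisfy the KP forward ceiling at EVERY scale ratio `1+ε₀ ∈ [29/20, 2]` (S = univ, θ = 101/200): every
strand is a Katz–Pavlović chain, RUNGS 2–4 and 10–12 apply strand-wise (v10: range widened from `[25/16, 2]`; v14: from `[149/100, 2]`
to `[29/20, 2]` via `Theorems.kpPermGap3Wide_ceilingAt`). -/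
theorem rung_kpPerm : ∀ R : ℝ, ∀ ε₀ : ℝ, 9 / 20 ≤ ε₀ → ε₀ ≤ 1 →
    ∀ (σ : Equiv.Perm (Fin 4)) (c : Fin 4 → ℝ), (∀ a, c (σ a) = c a) →
      FwdCeilingKPAt R ε₀ (Summit.NavierStokesRegularity.NavierStokesRegularity.Theorems.kpPermTable σ c) := by
  intro R ε₀ hε hε1 σ c hcyc
  exact fwdCeilingKPAt_of_ceilingAt
    (Summit.NavierStokesRegularity.NavierStokesRegularity.Theorems.kpPermGap3Wide_ceilingAt hcyc R ε₀ hε hε1)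

/-- RUNG 7 (LEAD SE ns-senv-p1, landed for 27130: `Theorems.kpFanWide_ceilingAt`; wired here by LEAD g6): uniform KP FAN
networks `kpFanTable w` (every mode feeds mode `i` with the same weight `w i`; the orthant binder forces `w ≥ 0`) satisfy
the KP forward ceiling at EVERY scale ratio `1+ε₀ ∈ [29/20, 2]` (S = univ, θ = 101/200): balanced branching / merging
collapses onto the chain (v10: range widened from `[25/16, 2]`; v14: to `[29/20, 2]` via `Theorems.kpFanGap3Wide_ceilingAt`). -/
theorem rung_kpFan : ∀ R : ℝ, ∀ ε₀ : ℝ, 9 / 20 ≤ ε₀ → ε₀ ≤ 1 → ∀ w : Fin 4 → ℝ,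
    FwdCeilingKPAt R ε₀ (Summit.NavierStokesRegularity.NavierStokesRegularity.Theorems.kpFanTable w) := by
  intro R ε₀ hε hε1 w
  exact fwdCeilingKPAt_of_ceilingAt
    (Summit.NavierStokesRegularity.NavierStokesRegularity.Theorems.kpFanGap3Wide_ceilingAt w R ε₀ hε hε1)

/-- RUNG 8 (LEAD SE ns-senv-p1, landed for 27130: `Theorems.kpTwoCycleWide_ceilingAt`; wired here by LEAD g6): the
UNIFORM re-entry pair `kpTwoCycleTable c c` (feeds `0 → 1 → 0` with equal weights `c > 0`) satisfies the KP forward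
ceiling at EVERY scale ratio `1+ε₀ ∈ [29/20, 2]` (S = univ, θ = 101/200): its two strands are Katz–Pavlović chains
(v10: range widened from `[81/50, 2]` via RUNGS 4 and 10; v14: to `[29/20, 2]` via `Theorems.kpTwoCycleGap3Wide_ceilingAt`).
ASYMMETRIC weights `c₀ ≠ c₁` are NOT covered (strands = chains with alternating rate ratio `L·(c₁/c₀)^{±2}`; census v9 §G:
one two-window region serves both bonds only while `min ratio ≥ 2.0` at `b = 2`, i.e. `c₀/c₁ ∈ [0.71, 1.41]`, uncertified). -/
theorem rung_kpTwoCycle : ∀ R : ℝ, ∀ ε₀ : ℝ, 9 / 20 ≤ ε₀ → ε₀ ≤ 1 → ∀ c : ℝ, 0 < c →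
    FwdCeilingKPAt R ε₀ (Summit.NavierStokesRegularity.NavierStokesRegularity.Theorems.kpTwoCycleTable c c) := by
  intro R ε₀ hε hε1 c hc
  exact fwdCeilingKPAt_of_ceilingAt
    (Summit.NavierStokesRegularity.NavierStokesRegularity.Theorems.kpTwoCycleGap3Wide_ceilingAt hc R ε₀ hε hε1)

/-- The STRUCTURAL CLAUSES of a grading `lev : Fin 4 → ℕ` of the modes of `α` (verbatim the hypothesis `hstruct` of
LEAD SE's `fwdCeilingKP_of_gradedEnvelope`): every forward source `a` of level `≥ 1` has all its feeders, all its in-shell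
partners and — for some target `e` — all feed targets and pump partners of `e` ADMISSIBLE: of strictly lower level and
either of level `0` or forward sources themselves. -/
def GradedStruct (α : Fin 4 → Fin 4 → Fin 4 → ℤ × ℤ × ℤ → ℝ) (lev : Fin 4 → ℕ) : Prop :=
  ∀ a, lev a ≠ 0 → (∃ e, α a a e (0, 0, 1) ≠ 0) →
    (∀ j, α j j a (0, 0, 1) ≠ 0 → lev j < lev a ∧ (lev j = 0 ∨ ∃ e', α j j e' (0, 0, 1) ≠ 0)) ∧
    (∀ i₁ i₂, i₁ ≠ a → i₂ ≠ a → α i₁ i₂ a (0, 0, 0) ≠ 0 →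
      (lev i₁ < lev a ∧ (lev i₁ = 0 ∨ ∃ e', α i₁ i₁ e' (0, 0, 1) ≠ 0)) ∧
      (lev i₂ < lev a ∧ (lev i₂ = 0 ∨ ∃ e', α i₂ i₂ e' (0, 0, 1) ≠ 0))) ∧
    (∃ e, α a a e (0, 0, 1) ≠ 0 ∧
      (∀ j, α e e j (0, 0, 1) ≠ 0 → lev j < lev a ∧ (lev j = 0 ∨ ∃ e', α j j e' (0, 0, 1) ≠ 0)) ∧
      (∀ j, j ≠ e → α e e j (0, 0, 0) ≠ 0 →
        lev j < lev a ∧ (lev j = 0 ∨ ∃ e', α j j e' (0, 0, 1) ≠ 0)))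

/-- The PRIMARY GRADED BARRIER for one table at one scale ratio: if `α ∈ E₂(R)` is orthant with diagonal feeds, then
SOME grading of its modes (levels `≤ L`) satisfies the structural clauses and its level-0 («primary») modes obey a
ν-UNIFORM weighted shell barrier `(1+ε₀)^{2θk}·½X_{i,k}(t)² ≤ D·E₀`, `1/2 < θ ≤ 1`, along every honest non-negative
viscous solution from every one-shell datum. [skeleton v6] -/
def PrimaryGradedAt (R ε₀ : ℝ) (α : Fin 4 → Fin 4 → Fin 4 → ℤ × ℤ × ℤ → ℝ) : Prop :=
  Literature.Analysis.FluidPDE.TaoCascade.InTableClass R α →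
  (∀ (Y : Fin 4 → ℤ → ℝ → ℝ) (τ : ℝ), (∀ (j : Fin 4) (k : ℤ), 1 ≤ k → 0 ≤ Y j k τ) → ∀ δ : ℝ, 0 < δ →
    ∀ (i : Fin 4) (n : ℤ), 1 ≤ n → Y i n τ = 0 → 0 ≤ Literature.Analysis.FluidPDE.TaoCascade.quadTerm δ α Y i n τ) →
  (∀ a b i : Fin 4, a ≠ b → α a b i (0, 0, 1) = 0) →
  ∃ (lev : Fin 4 → ℕ) (L : ℕ), (∀ a, lev a ≤ L) ∧ GradedStruct α lev ∧
    ∃ θ : ℝ, 1 / 2 < θ ∧ θ ≤ 1 ∧ ∃ D : ℝ, 0 ≤ D ∧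
      ∀ ν : ℝ, 0 < ν → ∀ (X₀ : Fin 4 → ℝ) (s : ℝ), 0 < s → ∀ X : Fin 4 → ℤ → ℝ → ℝ,
      (∀ (i : Fin 4) (k : ℤ), X i k 0 = if k = 0 then X₀ i else 0) →
      (∀ (i : Fin 4) (k : ℤ), k < 0 → ∀ t : ℝ, X i k t = 0) →
      (∃ M : ℝ, ∀ (t : ℝ) (i : Fin 4) (k : ℤ), (1 + (1 + ε₀) ^ ((10 : ℝ) * k)) * |X i k t| ≤ M) →
      (∀ (i : Fin 4) (k : ℤ), Continuous (X i k)) →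
      (∀ (i : Fin 4) (k : ℤ), ∀ t ∈ Set.Icc (0 : ℝ) s, HasDerivWithinAt (X i k)
        (Literature.Analysis.FluidPDE.TaoCascade.quadTerm ε₀ α X i k t - ν * (1 + ε₀) ^ ((2 : ℝ) * k) * X i k t)
        (Set.Icc (0 : ℝ) s) t) →
      (∀ t ∈ Set.Icc (0 : ℝ) s, ∀ (i : Fin 4) (k : ℤ), 1 ≤ k → 0 ≤ X i k t) →
      ∀ t ∈ Set.Icc (0 : ℝ) s, ∀ i, lev i = 0 → ∀ k : ℕ,
        (1 + ε₀) ^ (2 * θ * (k : ℝ)) * ((1 / 2 : ℝ) * X i (k : ℤ) t ^ 2) ≤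
          D * (∑ j : Fin 4, (1 / 2 : ℝ) * X₀ j ^ 2)

/-- A primary graded barrier gives the KP forward ceiling for the table — LEAD SE's graded assembly (multi-step pair
slaving of every secondary source), cited by name. -/
theorem fwdCeilingKPAt_of_primaryGraded {R ε₀ : ℝ} (hR : 1 ≤ R) (h0 : 0 < ε₀) (hle : ε₀ ≤ 1)
    {α : Fin 4 → Fin 4 → Fin 4 → ℤ × ℤ × ℤ → ℝ} (h : PrimaryGradedAt R ε₀ α) : FwdCeilingKPAt R ε₀ α := by
  intro hT hO hD
  obtain ⟨lev, L, hL, hstruct, θ, hθ, hθ1, D, _hD, hprim⟩ := h hT hO hD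
  exact Summit.NavierStokesRegularity.NavierStokesRegularity.Theorems.fwdCeilingKP_of_gradedEnvelope lev hL hR h0 hle
    hθ hθ1 hstruct hprim hT hO hD

/-- Registered stub statement STUB 1 (v6; large ratio, 1/4 < ε₀ ≤ 1): the PRIMARY GRADED BARRIER for every KP network
proper of `E₂(R)` — some grading with structural clauses whose primary modes obey a ν-uniform θ-shell barrier,
1/2 < θ ≤ 1. Contains: the λ-uniform Barbato–Morandin–Romito / Cheskidov–Zaya problem for the Katz–Pavlović chain
at every b ∈ [5/4, 2) (≥ open in print), the chain under the slaved in-shell drains of its secondaries (joint regions;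
RUNG 5 = small drains at b ∈ [1.9,2]), and the re-entry / pump-cycle architectures (their modes must sit at level 0). -/
def Sig.stub_primaryGradedLargeRatio : Prop := ∀ R : ℝ, 1 ≤ R → ∀ ε₀ : ℝ, 1 / 4 < ε₀ → ε₀ ≤ 1 →
    ∀ α : Fin 4 → Fin 4 → Fin 4 → ℤ × ℤ × ℤ → ℝ, PrimaryGradedAt R ε₀ α

/-- Registered stub statement STUB 2 (v6; small ratio, 0 < ε₀ ≤ 1/4; HARDEST): the same as b ↓ 1 (front exponent of the
primary network > 1/2 uniformly; the dumbbell / chain minimum W ≈ 1.23 near ε₀ = 1/8 is the kill line). -/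
def Sig.stub_primaryGradedSmallRatio : Prop := ∀ R : ℝ, 1 ≤ R → ∀ ε₀ : ℝ, 0 < ε₀ → ε₀ ≤ 1 / 4 →
    ∀ α : Fin 4 → Fin 4 → Fin 4 → ℤ × ℤ × ℤ → ℝ, PrimaryGradedAt R ε₀ α

theorem stub_primaryGradedLargeRatio : Sig.stub_primaryGradedLargeRatio := by
  sorry

theorem stub_primaryGradedSmallRatio : Sig.stub_primaryGradedSmallRatio := by
  sorry

/-- Composition (v19): the two PRIMARY GRADED BARRIER stubs give the crux BY NAME through LEAD SE's graded assembly;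
the landed rungs (one-mode chain at every b ∈ [137/100, 2]; uniform permutation and fan networks and the uniform 2-cycle at every b ∈ [29/20, 2];
the side-branch class at b ∈ [1.9, 2], its halved-pump sub-class at b ∈ [1.78, 2]) are kept as
proved corners of the case split. -/
theorem ForwardTailCeilingKP_of :
    Sig.stub_primaryGradedLargeRatio → Sig.stub_primaryGradedSmallRatio →
      Summit.NavierStokesRegularity.NavierStokesRegularity.Theses.SubOnsagerCeiling.ForwardTailCeilingKP := by
  intro h1 h2
  rw [forwardTailCeilingKP_iff]
  intro R hR ε₀ h0 hle α
  by_cases hq : ε₀ ≤ 1 / 4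
  · exact fwdCeilingKPAt_of_primaryGraded hR h0 hle (h2 R hR ε₀ h0 hq α)
  · by_cases hd : 37 / 100 ≤ ε₀ ∧ IsScaledDyadic α
    · -- proved corner: one-mode chain at scale ratios b ∈ [137/100, 2] (RUNG 17 ⊇ 16 ⊇ 15 ⊇ 14 ⊇ 13 ⊇ 12 ⊇ 11 ⊇ 10b ⊇ 10 ⊇ 4 ⊇ … ⊇ 1)
      exact rung_dyadicGapRange R hR ε₀ hd.1 hle α hd.2
    · by_cases hsb : 9 / 10 ≤ ε₀ ∧ SideBranchClassAt ε₀ α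
      · -- proved corner: the side-branch class (dead-end pocket) at b ∈ [1.9, 2] (RUNG 5)
        exact rung_sideBranchClass R ε₀ hsb.1 hle α hsb.2
      · by_cases hsb10 : 39 / 50 ≤ ε₀ ∧ SideBranchClassTenAt ε₀ α
        · -- proved corner: the halved-pump side-branch class at b ∈ [1.78, 2] (RUNG 9)
          exact rung_sideBranchClassTen R ε₀ hsb10.1 hle α hsb10.2
        by_cases hperm : 9 / 20 ≤ ε₀ ∧ ∃ (σ : Equiv.Perm (Fin 4)) (c : Fin 4 → ℝ), (∀ a, c (σ a) = c a) ∧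
            α = Summit.NavierStokesRegularity.NavierStokesRegularity.Theorems.kpPermTable σ c
        · -- proved corner: uniform KP permutation networks at b ∈ [29/20, 2] (RUNG 6; v11: [1.49, 2]; v14: [1.45, 2])
          obtain ⟨hε, σ, c, hcyc, rfl⟩ := hperm
          exact rung_kpPerm R ε₀ hε hle σ c hcyc
        · by_cases hfan : 9 / 20 ≤ ε₀ ∧ ∃ w : Fin 4 → ℝ,
              α = Summit.NavierStokesRegularity.NavierStokesRegularity.Theorems.kpFanTable w
          · -- proved corner: uniform KP fan networks at b ∈ [29/20, 2] (RUNG 7; v11: [1.49, 2]; v14: [1.45, 2])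
            obtain ⟨hε, w, rfl⟩ := hfan
            exact rung_kpFan R ε₀ hε hle w
          · by_cases hcyc2 : 9 / 20 ≤ ε₀ ∧ ∃ c : ℝ, 0 < c ∧
                α = Summit.NavierStokesRegularity.NavierStokesRegularity.Theorems.kpTwoCycleTable c c
            · -- proved corner: the uniform re-entry pair (2-cycle) at b ∈ [29/20, 2] (RUNG 8; v11: [1.49, 2]; v14: [1.45, 2])
              obtain ⟨hε, c, hc, rfl⟩ := hcyc2
              exact rung_kpTwoCycle R ε₀ hε hle c hc
            · exact fwdCeilingKPAt_of_primaryGraded hR h0 hle (h1 R hR ε₀ (lt_of_not_ge hq) hle α)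

end Summit.NavierStokesRegularity.NavierStokesRegularity.Cruxes.ForwardTailCeilingKP.KPShellBarrier
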